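import Literature.NumberTheory.EllipticCurves.CasselsTateGeneralCaseKernel
import Literature.NumberTheory.EllipticCurves.ArchimedeanWeilPairingDuality
import HarnessLib

/-!
# The Cassels–Tate pairing at level `m`: `2⟨a, a⟩ = 0`, hence `⟨a, a⟩ = 0` at odd levels

Topic `NumberTheory/EllipticCurves`; namespace `Literature.NumberTheory.EllipticCurves`. Definitions with
bodies and theorems only: **no named fact is introduced** (D-0026); same explicit inputs as
`CasselsTateGeneralCase.lean` (`halt`, `hPT' : inv.SumInvLocalizationEqZero`, and for the corollaries on
`ctGeneralFun`: `hH3`, `hfin`).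

For `a ∈ Ш(E/K)[m]` paired with ITSELF by the general case of Milne's construction (data with `b' = b`,
`β' = β`; `CasselsTateGeneralCase.GeneralCaseData`), the local `2`-cocycles satisfy, at every place `v`
and pointwise on `Γ_v`,

  `G_v = 2 z_v + κ_v ∪_{m²} κ_v - d h_v`,   `h_v(σ) = e_{m²}(κ_v σ, β_{1,v} σ - κ_v σ)`,

where `G = β₁ ∪_{m²} β₁ + H - 2ε`, `H(σ, τ) = desc(f(σ, τ), β(στ))`, is a GLOBAL continuous `2`-cocycle of
`μ_{m²}` (`d(β₁ ∪ β₁) = dβ₁ ∪ β₁ - β₁ ∪ dβ₁ = dε + (dε - dH)` by the skew-symmetry of the Weil pairing).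
Since `[κ_v ∪ κ_v] = 0` (isotropy of the local Kummer condition) this gives `inv_v(loc_v G) = 2 t_v`,
and the reciprocity law yields **`2⟨a, a⟩ = 0`** (`two_nsmul_sumOn_self_eq_zero`,
`two_nsmul_ctGeneralFun_self_eq_zero`); at ODD levels `m`, `2` is a unit of `ℤ/m²` and the pairing is
ALTERNATING, `⟨a, a⟩ = 0` (`ctGeneralFun_self_eq_zero_of_odd`) — the input `hct_alt` of
`CasselsTateLevelAssembly.isLevelPairing_ctLevelPairing` at odd levels.  (At even levels alternation is
Cassels' theorem and is not addressed here; the computation above is the cochain form of the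
antisymmetry of the pairing, Poonen–Stoll 1999, §6, specialised to `a = a'`.)

## References

* [MilneADT2006] J. S. Milne, *Arithmetic Duality Theorems*, 2nd ed. (2006), Ch. I §6, Prop. 6.9 and
  Rem. 6.10–6.11 (antisymmetry / alternation of the pairing).
* [SilvermanAEC2009] J. H. Silverman, *The Arithmetic of Elliptic Curves*, 2nd ed. (2009),
  Prop. III.8.1 (the Weil pairing is alternating).
-/

noncomputable section

open scoped Classical

universe u

namespace Literature.NumberTheory.EllipticCurves

open CategoryTheory _root_.WeierstrassCurve Field Function NumberField
open Literature.NumberTheory.GaloisRepresentations Literature.NumberTheory.GaloisCohomology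
open Literature.NumberTheory.GaloisRepresentations.DiscreteGaloisModule (mu MuCarrier pairing)
open scoped ContRepresentation

-- Cup products need `LocallyCompactSpace Γ`; as in the tree's cup-product files, the compactness of
-- absolute Galois groups is a local instance only.
attribute [local instance] absoluteGaloisGroup_compactSpace

-- `char K_v = 0` for the completions of a number field (the tree's theorem `charZero_placeCompletion`;
-- local instance, no override).
attribute [local instance] charZero_placeCompletion

/-! ## The algebra of the computation -/

section Algebra

variable {A M : Type*} [AddCommGroup A] [AddCommGroup M] (w : A →+ A →+ M)

/-- **The local identity `G_v - (2 z_v + κ ∪ κ - dh) = e(β₁σ - κσ, σ(β₁τ - κτ))`** of the self-pairing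
computation, as pure algebra for an alternating bi-additive `w` (atoms: `X = β₁σ`, `Y = σ β₁τ`, `P = β₁(στ)`,
`U = κσ`, `V = σ κτ`; the right-hand side vanishes because both arguments are `m`-torsion points of `E[m²]`,
hypothesis `hz`). [folklore] -/
theorem selfPairing_local_identity (hself : ∀ a, w a a = 0) (hswap : ∀ a b, w b a = -w a b)
    (X Y P U V : A) (ε : M) (hz : w (X - U) (Y - V) = 0) :
    w X Y + w (Y - P + X) (U + V) - ε - ε =
      (w (X - U) V - ε) + (w (X - U) V - ε) + w U (U + V - U) -
        (w V (Y - V) - w (U + V) (P - (U + V)) + w U (X - U)) := by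
  rw [← sub_eq_zero]
  have key : w X Y + w (Y - P + X) (U + V) - ε - ε -
      ((w (X - U) V - ε) + (w (X - U) V - ε) + w U (U + V - U) -
        (w V (Y - V) - w (U + V) (P - (U + V)) + w U (X - U))) = w (X - U) (Y - V) := by
    simp only [map_add, map_sub, AddMonoidHom.add_apply, AddMonoidHom.sub_apply, hself, sub_zero,
      add_zero, zero_add]
    rw [hswap Y V, hswap P U, hswap P V, hswap U V, hswap X U, hswap Y U]
    abel
  rw [key, hz]

/-- **The global identity `d(β₁ ∪ β₁) = A + B`** as pure algebra (atoms `X = β₁σ`, `Y = σβ₁τ`,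
`P = β₁(στ)`, `Q = στ β₁υ`, `R = σ β₁(τυ)`; `dβ₁(σ,τ) = Y - P + X`, `σ dβ₁(τ,υ) = Q - R + Y`). [folklore] -/
theorem selfPairing_global_identity (hswap : ∀ a b, w b a = -w a b) (X Y P Q R : A) :
    w Y Q - w P Q + w X R - w X Y = w (Y - P + X) Q + w (Q - R + Y) X := by
  simp only [map_add, map_sub, AddMonoidHom.add_apply, AddMonoidHom.sub_apply]
  rw [hswap X Q, hswap X R, hswap X Y]
  abel

end Algebra

section Self

variable {K : Type u} [Field K] [NumberField K] {W : WeierstrassCurve K} {m : ℕ} [NeZero m]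
variable {e : geomTorsion W ((m * m : ℕ) : ℤ) → geomTorsion W ((m * m : ℕ) : ℤ) → AlgebraicClosure K}
  {hμ : ∀ S T, e S T ^ (m * m) = 1}
  {hadd₁ : ∀ S₁ S₂ T, e (S₁ + S₂) T = e S₁ T * e S₂ T}
  {hadd₂ : ∀ S T₁ T₂, e S (T₁ + T₂) = e S T₁ * e S T₂}
  {hgal : ∀ (σ : absoluteGaloisGroup K) (S T : geomTorsion W ((m * m : ℕ) : ℤ)),
    σ • e S T = e (σ • S) (σ • T)}

namespace GeneralCaseData

variable (inv : LocalInvariants K (m * m)) (D : GeneralCaseData W m e hμ hadd₁ hadd₂ hgal)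

/-! ## Equivariance and compatibilities of the pairings (pointwise forms) -/

omit [NumberField K] in
/-- `σ e(S, T) = e(σS, σT)` for the Weil pairing hom at level `m²`. [cite: SilvermanAEC2009, Prop. III.8.1(d)] -/
theorem smul_weilPairingHom
    (hgal : ∀ (σ : absoluteGaloisGroup K) (S T : geomTorsion W ((m * m : ℕ) : ℤ)), σ • e S T = e (σ • S) (σ • T))
    (σ : absoluteGaloisGroup K) (S T : geomTorsion W ((m * m : ℕ) : ℤ)) :
    (mu K (m * m)).toTopRep.ρ σ (weilPairingHom W (m * m) e hμ hadd₁ hadd₂ S T) =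
      weilPairingHom W (m * m) e hμ hadd₁ hadd₂ (σ • S) (σ • T) :=
  ((weilContPairing W (m * m) e hμ hadd₁ hadd₂ hgal).toLin_smul σ S T).symm

/-- `σ desc(S, T) = desc(σS, σT)` for the descended pairing. [folklore] -/
theorem smul_descendHom
    (hgal : ∀ (σ : absoluteGaloisGroup K) (S T : geomTorsion W ((m * m : ℕ) : ℤ)), σ • e S T = e (σ • S) (σ • T))
    (σ : absoluteGaloisGroup K) (S T : geomTorsion W (m : ℤ)) :
    (mu K (m * m)).toTopRep.ρ σ (descendHom W m m e hμ hadd₁ hadd₂ S T) =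
      descendHom W m m e hμ hadd₁ hadd₂ (σ • S) (σ • T) :=
  (descendHom_smul W m m e hμ hadd₁ hadd₂ hgal σ S T).symm

/-- `desc(f(σ, τ), στ β(υ)) = e(ι f(σ, τ), στ β₁(υ))` (`[m](στ β₁υ) = στ βυ`). [folklore] -/
theorem descendHom_f_smul_β (σ τ υ : absoluteGaloisGroup K) :
    descendHom W m m e hμ hadd₁ hadd₂ (D.f.1 (σ, τ)) ((σ * τ) • D.β.1 υ) =
      weilPairingHom W (m * m) e hμ hadd₁ hadd₂ (σ • D.β₁ τ - D.β₁ (σ * τ) + D.β₁ σ) ((σ * τ) • D.β₁ υ) := by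
  rw [descendHom_apply_eq W m m e hμ hadd₁ hadd₂ (D.f.1 (σ, τ)) ((σ * τ) • D.β.1 υ) ((σ * τ) • D.β₁ υ)
    (by rw [mulK_smul, D.mulK_β₁]), D.inclKD_f]

/-- `desc(σ f(τ, υ), β(σ)) = e(στ β₁υ - σ β₁(τυ) + σ β₁τ, β₁σ)` (`[m] β₁σ = βσ`). [folklore] -/
theorem descendHom_smul_f_β (σ τ υ : absoluteGaloisGroup K) :
    descendHom W m m e hμ hadd₁ hadd₂ (σ • D.f.1 (τ, υ)) (D.β.1 σ) =
      weilPairingHom W (m * m) e hμ hadd₁ hadd₂ ((σ * τ) • D.β₁ υ - σ • D.β₁ (τ * υ) + σ • D.β₁ τ) (D.β₁ σ) := by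
  rw [descendHom_apply_eq W m m e hμ hadd₁ hadd₂ (σ • D.f.1 (τ, υ)) (D.β.1 σ) (D.β₁ σ) (D.mulK_β₁ σ), inclKD_smul,
    D.inclKD_f, smul_add, smul_sub, smul_smul]

/-! ## The global `2`-cocycle `G = β₁ ∪ β₁ + H - 2ε` -/

/-- **The `2`-cochain `β₁ ∪_{m²} β₁`**: `(σ, τ) ↦ e_{m²}(β₁σ, σ β₁τ)`. [folklore] -/
def betaCup : C(absoluteGaloisGroup K × absoluteGaloisGroup K, MuCarrier K (m * m)) :=
  ⟨fun p => weilPairingHom W (m * m) e hμ hadd₁ hadd₂ (D.β₁ p.1) (p.1 • D.β₁ p.2),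
    Continuous.comp (g := fun q : geomTorsion W ((m * m : ℕ) : ℤ) × geomTorsion W ((m * m : ℕ) : ℤ) =>
        weilPairingHom W (m * m) e hμ hadd₁ hadd₂ q.1 q.2)
      continuous_of_discreteTopology ((D.β₁.continuous.comp continuous_fst).prodMk
        ((W.torsionGaloisModule ((m * m : ℕ) : ℤ)).continuous_apply₂.comp
          (continuous_fst.prodMk (D.β₁.continuous.comp continuous_snd))))⟩

/-- Unfolding `betaCup`. [folklore] -/
@[simp]
theorem betaCup_apply (σ τ : absoluteGaloisGroup K) :
    D.betaCup (σ, τ) = weilPairingHom W (m * m) e hμ hadd₁ hadd₂ (D.β₁ σ) (σ • D.β₁ τ) := rfl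

/-- **The `2`-cochain `H(σ, τ) = desc(f(σ, τ), β(στ))`** (`dH = f ∪ β - β ∪ᵗ f`, the homotopy between
the two cup products of the `2`-cocycle `f` and the `1`-cocycle `β`). [folklore] -/
def hCup : C(absoluteGaloisGroup K × absoluteGaloisGroup K, MuCarrier K (m * m)) :=
  ⟨fun p => descendHom W m m e hμ hadd₁ hadd₂ (D.f.1 p) (D.β.1 (p.1 * p.2)),
    Continuous.comp (g := fun q : geomTorsion W (m : ℤ) × geomTorsion W (m : ℤ) =>
        descendHom W m m e hμ hadd₁ hadd₂ q.1 q.2)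
      continuous_of_discreteTopology (D.f.1.continuous.prodMk
        (D.β.1.continuous.comp (continuous_fst.mul continuous_snd)))⟩

/-- Unfolding `hCup`. [folklore] -/
@[simp]
theorem hCup_apply (σ τ : absoluteGaloisGroup K) :
    D.hCup (σ, τ) = descendHom W m m e hμ hadd₁ hadd₂ (D.f.1 (σ, τ)) (D.β.1 (σ * τ)) := rfl

/-- **`d(β₁ ∪ β₁) = A + B`**, `A(σ,τ,υ) = desc(f(σ,τ), στ βυ)`, `B(σ,τ,υ) = desc(σ f(τ,υ), βσ)`
(Leibniz: `d(β₁ ∪ β₁) = dβ₁ ∪ β₁ - β₁ ∪ dβ₁`, `dβ₁ = ι f`, `[m]β₁ = β`, and `e_{m²}` skew-symmetric).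
[cite: SilvermanAEC2009, Prop. III.8.1(b)] -/
theorem dTwo_betaCup (halt : ∀ T, e T T = 1) (σ τ υ : absoluteGaloisGroup K) :
    dTwo (mu K (m * m)).toTopRep D.betaCup σ τ υ =
      descendHom W m m e hμ hadd₁ hadd₂ (D.f.1 (σ, τ)) ((σ * τ) • D.β.1 υ) +
        descendHom W m m e hμ hadd₁ hadd₂ (σ • D.f.1 (τ, υ)) (D.β.1 σ) := by
  rw [dTwo_apply, betaCup_apply, betaCup_apply, betaCup_apply, betaCup_apply, smul_weilPairingHom hgal,
    smul_smul, descendHom_f_smul_β, descendHom_smul_f_β]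
  exact selfPairing_global_identity (weilPairingHom W (m * m) e hμ hadd₁ hadd₂)
    (weilPairingHom_swap_eq_neg W (m * m) e hμ hadd₁ hadd₂ halt) _ _ _ _ _

/-- **`dε = A`** when `β' = β`: `dε = f ∪_desc β`. [folklore] -/
theorem dTwo_eps_of_self (hβ' : D.β' = D.β) (σ τ υ : absoluteGaloisGroup K) :
    dTwo (mu K (m * m)).toTopRep D.ε σ τ υ =
      descendHom W m m e hμ hadd₁ hadd₂ (D.f.1 (σ, τ)) ((σ * τ) • D.β.1 υ) := by
  rw [← D.dTwo_ε, ContPairing.cupCocycle₂₁_apply, descendPairing_toLin_apply, hβ', contOneCocycles.apply_mul_sub]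
  rfl

/-- **`dH = A - B`** (the `2`-cocycle identity of `f` and the `1`-cocycle identity of `β`). [folklore] -/
theorem dTwo_hCup (σ τ υ : absoluteGaloisGroup K) :
    dTwo (mu K (m * m)).toTopRep D.hCup σ τ υ =
      descendHom W m m e hμ hadd₁ hadd₂ (D.f.1 (σ, τ)) ((σ * τ) • D.β.1 υ) -
        descendHom W m m e hμ hadd₁ hadd₂ (σ • D.f.1 (τ, υ)) (D.β.1 σ) := by
  have hf2 : σ • D.f.1 (τ, υ) = D.f.1 (σ * τ, υ) + D.f.1 (σ, τ) - D.f.1 (σ, τ * υ) :=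
    contTwoCocycles.smul_apply D.f σ τ υ
  have hb2 : D.β.1 (σ * τ * υ) = D.β.1 (σ * τ) + (σ * τ) • D.β.1 υ := D.β.2 (σ * τ) υ
  have hb1 : D.β.1 (σ * (τ * υ)) = D.β.1 σ + σ • D.β.1 (τ * υ) := D.β.2 σ (τ * υ)
  have hg1 : σ • D.β.1 (τ * υ) = D.β.1 (σ * τ) + (σ * τ) • D.β.1 υ - D.β.1 σ := by
    rw [eq_sub_iff_add_eq, add_comm (σ • D.β.1 (τ * υ)), ← hb1, ← mul_assoc, hb2]
  rw [dTwo_apply, hCup_apply, hCup_apply, hCup_apply, hCup_apply, smul_descendHom hgal, hg1, hb2,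
    ← mul_assoc, hb2, hf2]
  simp only [map_add, map_sub, AddMonoidHom.add_apply, AddMonoidHom.sub_apply]
  abel

/-- **The global `2`-cochain `G = β₁ ∪ β₁ + H - ε - ε`** of the self-pairing. [folklore] -/
def selfCochain : C(absoluteGaloisGroup K × absoluteGaloisGroup K, MuCarrier K (m * m)) :=
  D.betaCup + D.hCup - D.ε - D.ε

/-- Unfolding `selfCochain`. [folklore] -/
theorem selfCochain_apply (σ τ : absoluteGaloisGroup K) :
    D.selfCochain (σ, τ) =
      weilPairingHom W (m * m) e hμ hadd₁ hadd₂ (D.β₁ σ) (σ • D.β₁ τ) +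
        descendHom W m m e hμ hadd₁ hadd₂ (D.f.1 (σ, τ)) (D.β.1 (σ * τ)) - D.ε (σ, τ) - D.ε (σ, τ) :=
  rfl

/-- **`G` is a `2`-cocycle** when `β' = β`: `dG = (A + B) + (A - B) - A - A = 0`.
[cite: MilneADT2006, Ch. I §6, Rem. 6.10–6.11] -/
theorem dTwo_selfCochain (halt : ∀ T, e T T = 1) (hβ' : D.β' = D.β) (σ τ υ : absoluteGaloisGroup K) :
    dTwo (mu K (m * m)).toTopRep D.selfCochain σ τ υ = 0 := by
  rw [selfCochain, dTwo_sub, dTwo_sub, dTwo_add, D.dTwo_betaCup halt, D.dTwo_hCup, D.dTwo_eps_of_self hβ']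
  abel

/-- **The global `2`-cocycle `G`** of the self-pairing. [cite: MilneADT2006, Ch. I §6, Rem. 6.10–6.11] -/
def selfCocycle (halt : ∀ T, e T T = 1) (hβ' : D.β' = D.β) : contTwoCocycles (mu K (m * m)).toTopRep :=
  ⟨D.selfCochain, (mem_contTwoCocycles_iff_dTwo _ _).2 (D.dTwo_selfCochain halt hβ')⟩

/-! ## The local identity -/

/-- The action of `Γ_v` on `μ_{m²}` in the form `mu K (m²) (Γ_v → Γ_K)`, on a Weil-pairing value. [folklore] -/
theorem mu_weilPairingHom
    (hgal : ∀ (σ : absoluteGaloisGroup K) (S T : geomTorsion W ((m * m : ℕ) : ℤ)), σ • e S T = e (σ • S) (σ • T))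
    (v : Place K) (σ : absoluteGaloisGroup (Place.Completion v)) (S T : geomTorsion W ((m * m : ℕ) : ℤ)) :
    mu K (m * m) (absGaloisRestrict K (Place.Completion v) σ) (weilPairingHom W (m * m) e hμ hadd₁ hadd₂ S T) =
      weilPairingHom W (m * m) e hμ hadd₁ hadd₂ (absGaloisRestrict K (Place.Completion v) σ • S)
        (absGaloisRestrict K (Place.Completion v) σ • T) :=
  smul_weilPairingHom (hμ := hμ) (hadd₁ := hadd₁) (hadd₂ := hadd₂) hgal (absGaloisRestrict K (Place.Completion v) σ) S T

/-- **The local `1`-cochain `h_v(σ) = e_{m²}(κ_v σ, β_{1,v} σ - κ_v σ)`** on `Γ_v`. [folklore] -/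
def hLoc (v : Place K) : C(absoluteGaloisGroup (Place.Completion v), muRepAt (K := K) m (Place.Completion v)) :=
  ⟨fun σ => weilPairingHom W (m * m) e hμ hadd₁ hadd₂ ((D.κ v).1 σ)
      (D.β₁ (absGaloisRestrict K (Place.Completion v) σ) - (D.κ v).1 σ),
    Continuous.comp (g := fun q : geomTorsion W ((m * m : ℕ) : ℤ) × geomTorsion W ((m * m : ℕ) : ℤ) =>
        weilPairingHom W (m * m) e hμ hadd₁ hadd₂ q.1 q.2)
      continuous_of_discreteTopology ((D.κ v).1.continuous.prodMk
        ((D.β₁.continuous.comp (map_continuous (absGaloisRestrict K (Place.Completion v)))).sub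
          (D.κ v).1.continuous))⟩

/-- Unfolding `hLoc`. [folklore] -/
@[simp]
theorem hLoc_apply (v : Place K) (σ : absoluteGaloisGroup (Place.Completion v)) :
    D.hLoc v σ = weilPairingHom W (m * m) e hμ hadd₁ hadd₂ ((D.κ v).1 σ)
      (D.β₁ (absGaloisRestrict K (Place.Completion v) σ) - (D.κ v).1 σ) :=
  rfl

/-- The local cocycle of self-data, pointwise: `z_v(σ, τ) = e(β_{1,v}σ - κσ, σ κτ) - ε_v(σ, τ)`
(`desc(α⁰σ, σβτ) = e(ια⁰σ, σκτ)` as `[m](σκτ) = σβτ`). [folklore] -/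
theorem cocycle_apply_of_self (hβ' : D.β' = D.β) (v : Place K) (σ τ : absoluteGaloisGroup (Place.Completion v)) :
    (D.localData v).cocycle.1 (σ, τ) =
      weilPairingHom W (m * m) e hμ hadd₁ hadd₂
          (D.β₁ (absGaloisRestrict K (Place.Completion v) σ) - (D.κ v).1 σ)
          (absGaloisRestrict K (Place.Completion v) σ • (D.κ v).1 τ) -
        D.ε (absGaloisRestrict K (Place.Completion v) σ, absGaloisRestrict K (Place.Completion v) τ) := by
  have hκ : (D.κ v).1 (σ * τ) - (D.κ v).1 σ = absGaloisRestrict K (Place.Completion v) σ • (D.κ v).1 τ :=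
    contOneCocycles.apply_mul_sub (D.κ v) σ τ
  have hlift : mulK W m m (absGaloisRestrict K (Place.Completion v) σ • (D.κ v).1 τ) =
      (D.localData v).β'.1 (σ * τ) - (D.localData v).β'.1 σ := by
    rw [← hκ, map_sub, D.mulK_κ, D.mulK_κ, D.mulK_β₁, D.mulK_β₁]
    change _ = D.β'.1 (absGaloisRestrict K (Place.Completion v) (σ * τ)) -
      D.β'.1 (absGaloisRestrict K (Place.Completion v) σ)
    rw [hβ']
  rw [GeneralLocalData.cocycle_apply, descendHom_apply_eq W m m e hμ hadd₁ hadd₂ _ _ _ hlift,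
    inclKD_levelDown W m ((D.localData v).mulK_sub σ)]
  rfl

/-- `e(X - U, Y - V) = 0` for the `m`-torsion points `X - U = β_{1,v}σ - κσ` and
`Y - V = σ(β_{1,v}τ - κτ)` of `E[m²]` (`e_{m²}(ι S, T') = 0` when `m T' = 0`). [folklore] -/
theorem weilPairingHom_sub_sub_eq_zero (v : Place K) (σ τ : absoluteGaloisGroup (Place.Completion v)) :
    weilPairingHom W (m * m) e hμ hadd₁ hadd₂
        (D.β₁ (absGaloisRestrict K (Place.Completion v) σ) - (D.κ v).1 σ)
        (absGaloisRestrict K (Place.Completion v) σ • D.β₁ (absGaloisRestrict K (Place.Completion v) τ) -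
          absGaloisRestrict K (Place.Completion v) σ • (D.κ v).1 τ) = 0 := by
  have h0σ : mulK W m m (D.β₁ (absGaloisRestrict K (Place.Completion v) σ) - (D.κ v).1 σ) = 0 :=
    (D.localData v).mulK_sub σ
  have h0τ : mulK W m m (D.β₁ (absGaloisRestrict K (Place.Completion v) τ) - (D.κ v).1 τ) = 0 :=
    (D.localData v).mulK_sub τ
  have h1 : D.β₁ (absGaloisRestrict K (Place.Completion v) σ) - (D.κ v).1 σ =
      inclKD W m m (levelDown W m (D.β₁ (absGaloisRestrict K (Place.Completion v) σ) - (D.κ v).1 σ)) :=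
    (inclKD_levelDown W m h0σ).symm
  have hmul : mulK W m m (absGaloisRestrict K (Place.Completion v) σ • D.β₁ (absGaloisRestrict K (Place.Completion v) τ) -
      absGaloisRestrict K (Place.Completion v) σ • (D.κ v).1 τ) = 0 := by
    rw [← smul_sub, mulK_smul, h0τ, smul_zero]
  have hns : m • (absGaloisRestrict K (Place.Completion v) σ • D.β₁ (absGaloisRestrict K (Place.Completion v) τ) -
      absGaloisRestrict K (Place.Completion v) σ • (D.κ v).1 τ) = 0 := by
    apply Subtype.ext
    rw [AddSubgroup.coe_nsmul, ← natCast_zsmul, ← coe_mulK_apply, hmul, ZeroMemClass.coe_zero, ZeroMemClass.coe_zero]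
  rw [h1]
  exact weilPairingHom_inclKD_eq_zero_of_nsmul_eq_zero W m m e hμ hadd₁ hadd₂ _ _ hns

/-- **The local identity** `G_v = z_v + z_v + κ_v ∪ κ_v - dh_v` on `Γ_v × Γ_v` (module docstring).
[cite: MilneADT2006, Ch. I §6, Rem. 6.10–6.11] -/
theorem selfCochain_res_apply (halt : ∀ T, e T T = 1) (hβ' : D.β' = D.β) (v : Place K)
    (σ τ : absoluteGaloisGroup (Place.Completion v)) :
    D.selfCochain (absGaloisRestrict K (Place.Completion v) σ, absGaloisRestrict K (Place.Completion v) τ) =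
      (D.localData v).cocycle.1 (σ, τ) + (D.localData v).cocycle.1 (σ, τ) +
        (weilCup W m (Place.Completion v) e hμ hadd₁ hadd₂ hgal (D.κ v) (D.κ v)).1 (σ, τ) -
        (mu K (m * m) (absGaloisRestrict K (Place.Completion v) σ) (D.hLoc v τ) - D.hLoc v (σ * τ) + D.hLoc v σ) := by
  have hθ : absGaloisRestrict K (Place.Completion v) (σ * τ) =
      absGaloisRestrict K (Place.Completion v) σ * absGaloisRestrict K (Place.Completion v) τ := map_mul _ _ _
  have hκ2 : (D.κ v).1 (σ * τ) = (D.κ v).1 σ + absGaloisRestrict K (Place.Completion v) σ • (D.κ v).1 τ :=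
    (D.κ v).2 σ τ
  have hH : descendHom W m m e hμ hadd₁ hadd₂
        (D.f.1 (absGaloisRestrict K (Place.Completion v) σ, absGaloisRestrict K (Place.Completion v) τ))
        (D.β.1 (absGaloisRestrict K (Place.Completion v) σ * absGaloisRestrict K (Place.Completion v) τ)) =
      weilPairingHom W (m * m) e hμ hadd₁ hadd₂
        (absGaloisRestrict K (Place.Completion v) σ • D.β₁ (absGaloisRestrict K (Place.Completion v) τ) -
            D.β₁ (absGaloisRestrict K (Place.Completion v) σ * absGaloisRestrict K (Place.Completion v) τ) +
          D.β₁ (absGaloisRestrict K (Place.Completion v) σ))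
        ((D.κ v).1 (σ * τ)) := by
    rw [descendHom_apply_eq W m m e hμ hadd₁ hadd₂ _
      (D.β.1 (absGaloisRestrict K (Place.Completion v) σ * absGaloisRestrict K (Place.Completion v) τ))
      ((D.κ v).1 (σ * τ)) (by rw [D.mulK_κ, D.mulK_β₁, hθ]), D.inclKD_f]
  rw [selfCochain_apply, hH, D.cocycle_apply_of_self hβ' v, weilCup_apply, hLoc_apply, hLoc_apply, hLoc_apply,
    mu_weilPairingHom hgal, smul_sub, hθ, hκ2]
  exact selfPairing_local_identity (weilPairingHom W (m * m) e hμ hadd₁ hadd₂)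
    (weilPairingHom_self W (m * m) e hμ hadd₁ hadd₂ halt) (weilPairingHom_swap_eq_neg W (m * m) e hμ hadd₁ hadd₂ halt)
    _ _ _ _ _ _ (D.weilPairingHom_sub_sub_eq_zero v σ τ)

/-- **The local class of `G`**: `[G_v] = [z_v] + [z_v] + [κ_v ∪ κ_v]` in `H²(K_v, μ_{m²})` (`dh_v` is a
coboundary). [cite: MilneADT2006, Ch. I §6, Rem. 6.10–6.11] -/
theorem locClass₂_res_selfCocycle (halt : ∀ T, e T T = 1) (hβ' : D.β' = D.β) (v : Place K) :
    locClass₂ (mu K (m * m)) (Place.Completion v) (resTwo (mu K (m * m)) (Place.Completion v) (D.selfCocycle halt hβ')) =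
      locClass₂ _ _ (D.localData v).cocycle + locClass₂ _ _ (D.localData v).cocycle +
        locClass₂ _ _ (weilCup W m (Place.Completion v) e hμ hadd₁ hadd₂ hgal (D.κ v) (D.κ v)) := by
  rw [← locClass₂_add, ← locClass₂_add, ← sub_eq_zero, ← locClass₂_sub]
  refine (twoCocycleClass_eq_zero_iff _
    (resTwo (mu K (m * m)) (Place.Completion v) (D.selfCocycle halt hβ') -
      ((D.localData v).cocycle + (D.localData v).cocycle +
        weilCup W m (Place.Completion v) e hμ hadd₁ hadd₂ hgal (D.κ v) (D.κ v)))).2 ⟨-D.hLoc v, fun σ τ => ?_⟩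
  change D.selfCochain (absGaloisRestrict K (Place.Completion v) σ, absGaloisRestrict K (Place.Completion v) τ) -
      ((D.localData v).cocycle.1 (σ, τ) + (D.localData v).cocycle.1 (σ, τ) +
        (weilCup W m (Place.Completion v) e hμ hadd₁ hadd₂ hgal (D.κ v) (D.κ v)).1 (σ, τ)) =
    mu K (m * m) (absGaloisRestrict K (Place.Completion v) σ) ((-D.hLoc v) τ) - (-D.hLoc v) (σ * τ) + (-D.hLoc v) σ
  rw [D.selfCochain_res_apply halt hβ' v σ τ, ContinuousMap.neg_apply, ContinuousMap.neg_apply,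
    ContinuousMap.neg_apply, map_neg]
  abel

/-- **`inv_v(loc_v G) = 2 t_v`**: the class `[κ_v ∪ κ_v]` is killed by the isotropy of the local Kummer
condition (discharged fact `kummerClass_cupProduct_kummerClass_eq_zero_holds`).
[cite: MilneADT2006, Ch. I §6, Rem. 6.10–6.11] -/
theorem inv_locClass₂_res_selfCocycle [W.IsElliptic] (halt : ∀ T, e T T = 1) (hβ' : D.β' = D.β) (v : Place K) :
    inv v (locClass₂ (mu K (m * m)) (Place.Completion v)
      (resTwo (mu K (m * m)) (Place.Completion v) (D.selfCocycle halt hβ'))) =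
      D.localTerm inv v + D.localTerm inv v := by
  have hcl := D.locClass₂_res_selfCocycle halt hβ' v
  rw [locClass₂_weilCup, weilLocalCup_eq_zero_of_mem_of_fact W m (Place.Completion v) e hμ hadd₁ hadd₂ hgal
    (kummerClass_cupProduct_kummerClass_eq_zero_holds (Place.Completion v)) halt (D.κ_mem v) (D.κ_mem v),
    add_zero] at hcl
  unfold localTerm GeneralLocalData.term
  rw [← map_add]
  exact congrArg (inv v) hcl

/-! ## `2⟨a, a⟩ = 0` -/

-- `hPT'` is the reciprocity PREDICATE `LocalInvariants.SumInvLocalizationEqZero` on `inv`, not a named fact.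
/-- **`2 ∑_{v ∈ S} t_v = 0` for self-data** (`b' = b`, `β' = β`) whose local terms vanish outside `S`:
`∑_v inv_v(loc_v G) = 0` for the global `2`-cocycle `G` by the reciprocity law, and `inv_v(loc_v G) = 2 t_v`.
[cite: MilneADT2006, Ch. I §6, Rem. 6.10–6.11] -/
theorem two_nsmul_sumOn_self_eq_zero [W.IsElliptic] (halt : ∀ T, e T T = 1) (hPT' : inv.SumInvLocalizationEqZero)
    (hβ' : D.β' = D.β) {S : Finset (Place K)} (hS : ∀ v ∉ S, D.localTerm inv v = 0) :
    2 • D.sumOn inv S = 0 := by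
  have hlr : ∀ v, inv v (galoisCohomology.localization (mu K (m * m)) v 2
      (twoCocycleClass _ (D.selfCocycle halt hβ'))) = D.localTerm inv v + D.localTerm inv v := fun v =>
    (congrArg (inv v) (locClass₂_resTwo (mu K (m * m)) (Place.Completion v) (D.selfCocycle halt hβ'))).symm.trans
      (D.inv_locClass₂_res_selfCocycle inv halt hβ' v)
  have hc : ∀ v ∉ S, inv v (galoisCohomology.localization (mu K (m * m)) v 2
      (twoCocycleClass _ (D.selfCocycle halt hβ'))) = 0 := fun v hv => by
    rw [hlr, hS v hv, add_zero]
  have hsum := hPT' (twoCocycleClass _ (D.selfCocycle halt hβ')) S hc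
  rw [Finset.sum_congr rfl fun v _ => hlr v, Finset.sum_add_distrib] at hsum
  rw [two_nsmul]
  exact hsum

end GeneralCaseData

/-! ## Consequences for `ctGeneralFun` -/

section Pairing

variable (inv : LocalInvariants K (m * m)) (halt : ∀ T, e T T = 1) (hPT' : inv.SumInvLocalizationEqZero)
  (hH3 : ∀ c : galoisCohomology (mu K (m * m)) 3,
    (∀ v : Place K, galoisCohomology.localization (mu K (m * m)) v 3 c = 0) → c = 0)
  (hfin : ∀ D : GeneralCaseData W m e hμ hadd₁ hadd₂ hgal, ∃ S : Finset (Place K), ∀ v ∉ S, D.localTerm inv v = 0)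
include halt hPT' hH3 hfin

/-- **`2⟨a, a⟩ = 0`** for the general-case Cassels–Tate pairing of an `a ∈ Ш(E/K)[m]` with itself
(data with `b' = b`, `β' = β` exist by `exists_generalCaseData`, `exists_eps`, `withRight`).
[cite: MilneADT2006, Ch. I §6, Rem. 6.10–6.11] -/
theorem two_nsmul_ctGeneralFun_self_eq_zero [W.IsElliptic] {a : W.galH1} (ha : a ∈ W.sha) (hma : (m : ℤ) • a = 0) :
    2 • ctGeneralFun W m e hμ hadd₁ hadd₂ hgal inv a a = 0 := by
  obtain ⟨b, hbSel, rfl⟩ := exists_selmer_lift (W := W) (m := m) ha hma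
  obtain ⟨D₀, hD₀b, -⟩ := GeneralCaseData.exists_generalCaseData (e := e) (hμ := hμ) (hadd₁ := hadd₁)
    (hadd₂ := hadd₂) (hgal := hgal) hH3 hbSel hbSel
  have hβSel : oneCocycleClass _ D₀.β ∈ selmerGroup W (m : ℤ) := by
    rw [D₀.hβ]
    exact D₀.b_mem
  obtain ⟨ε, hε⟩ := D₀.exists_eps hH3 D₀.β
  let D : GeneralCaseData W m e hμ hadd₁ hadd₂ hgal := D₀.withRight D₀.β hβSel ε hε
  obtain ⟨S, hS⟩ := hfin D
  have h2 := D.two_nsmul_sumOn_self_eq_zero inv halt hPT' rfl hS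
  have e1 : torsionH1ToH1 W (m : ℤ) D.b' = torsionH1ToH1 W (m : ℤ) b := by
    show torsionH1ToH1 W (m : ℤ) (oneCocycleClass (W.torsionGaloisModule (m : ℤ)).toTopRep D₀.β) = _
    rw [D₀.hβ, hD₀b]
  have e2 : torsionH1ToH1 W (m : ℤ) D.b = torsionH1ToH1 W (m : ℤ) b := by
    show torsionH1ToH1 W (m : ℤ) D₀.b = _
    rw [hD₀b]
  have h := ctGeneralFun_eq inv halt hPT' D hS
  rw [e1, e2] at h
  rw [h]
  exact h2

/-- **The general-case Cassels–Tate pairing is alternating on `Ш[m]` at ODD levels `m`**: `⟨a, a⟩ = 0`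
(`2⟨a, a⟩ = 0` and `2` is a unit of `ℤ/m²`) — the input `hct_alt` of
`CasselsTateLevelAssembly.isLevelPairing_ctLevelPairing` for odd `m`. [cite: MilneADT2006, Ch. I §6, Rem. 6.10–6.11] -/
theorem ctGeneralFun_self_eq_zero_of_odd [W.IsElliptic] (hodd : Odd m) {a : W.galH1} (ha : a ∈ W.sha)
    (hma : (m : ℤ) • a = 0) : ctGeneralFun W m e hμ hadd₁ hadd₂ hgal inv a a = 0 := by
  have h2 := two_nsmul_ctGeneralFun_self_eq_zero inv halt hPT' hH3 hfin ha hma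
  have hu : IsUnit ((2 : ℕ) : ZMod (m * m)) :=
    (ZMod.isUnit_iff_coprime 2 (m * m)).2 (Nat.coprime_two_left.2 (hodd.mul hodd))
  rw [nsmul_eq_mul] at h2
  exact (hu.mul_right_eq_zero).1 h2

end Pairing

end Self

end Literature.NumberTheory.EllipticCurves

end
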